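import Summits.QuantumFields.YangMills.Theorems.FluctuationComparisonRegPrIntLWreg
import HarnessLib

/-!
# CHART∞ · V-c2a (LINE g18-1 `semiclassical_s2beta`, organ S2β, LAPLACE row): THE CLOSED PROFILE `closure histGood` and the null row of the law

Cell `ym3-torus` (rung R3: continuum `SU(2)` Yang–Mills on `T³` — NOT `d = 4`, NOT infinite volume, NOT a mass gap, NOT Clay); width seat `ym-ust-20520-w3` g14;
helper of the crux `stmt-QuantumFields-20520` (`--supports`, NOT a proof of it).  THEOREMS ONLY (0 `def`, default heartbeats).
The companion of record for `Sfine = histGood F 𝓔 θ K J` is its CLOSURE: inside the `≤`-profile set (✓`closure_histProfile_subset_and_continuousAt`), hence inside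
the chart-window set and with STRICT small loop history once `((d+2)L)²/4 · δ₀ < α` for a bound `θ < δ₀`; its frontier lies on the exact threshold levels
(✓`frontier_histGood_subset`).  §2 ★★ `null_row_of_levelFlat`: the displayed null row of ✓V-c1's `map_Φ` («`∀ V ∈ O`, a.e. `z`, `jac (V,z) ≠ 0 → Φ (V,z) ∈ histGood`»)
from ✓`levelFlat` (exact levels `j < K − J` are leafwise Haar-null; the top level is strict on the open window), for ANY chart data with the live-point
characterisation and the `charted` clause.  HONEST SCOPE: bookkeeping; LAPLACE ∕ S2β ∕ crux 20520 NOT proved; `YM3TorusSU2` NOT proved; the Yang–Mills mass gap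
(Clay) NOT proved.  [cite: Balaban1985UV3, (7) p.257 and (28)-(31) p.263] [cite: Balaban1987RG1, (0.4) p.253 and (2.9) p.266]
-/

noncomputable section

open MeasureTheory Filter Topology Set
open scoped ENNReal NNReal
open Literature.MathematicalPhysics.QuantumFieldTheory.Balaban1983to89
open Literature.MathematicalPhysics.QuantumFieldTheory.Balaban1983to89.T3ContinuumYM3Torus
open Literature.MathematicalPhysics.QuantumFieldTheory.Balaban1983to89.T3UnitLawDensityEML
open Literature.MathematicalPhysics.QuantumFieldTheory.Balaban1983to89.T3UnitScaleTilt
open Literature.MathematicalPhysics.QuantumFieldTheory.Balaban1983to89.T3TiltDescent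
open Literature.MathematicalPhysics.QuantumFieldTheory.Balaban1983to89.T3LevelShift
open Literature.MathematicalPhysics.QuantumFieldTheory.Balaban1983to89.T3Thresholds
open Literature.MathematicalPhysics.QuantumFieldTheory.Balaban1983to89.T4Continuum
open scoped Literature.MathematicalPhysics.QuantumFieldTheory.Balaban1983to89.T3OrbitAverage

namespace Summit.QuantumFields.YangMills.Theorems.FluctuationComparisonRegPrIntLS2BetaChartContClosedProfile

open Summit.QuantumFields.YangMills.Theorems.FluctuationComparisonRegPrIntLWregChain
open Summit.QuantumFields.YangMills.Theorems.FluctuationComparisonRegPrIntLWregFibredChart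
open Summit.QuantumFields.YangMills.Theorems.FluctuationComparisonRegPrIntLWregGlue
open Summit.QuantumFields.YangMills.Theorems.FluctuationComparisonRegPrIntLWregInterior
open Summit.QuantumFields.YangMills.Theorems.FluctuationComparisonRegPrIntLWregAssembly
open Function
open Literature.MathematicalPhysics.QuantumFieldTheory.Balaban1983to89.BlockAveraging (Idx loopHol)
open Literature.MathematicalPhysics.QuantumFieldTheory.Balaban1983to89.BlockAveragingEMLHaarAC (offCard)
open Literature.MathematicalPhysics.QuantumFieldTheory.Balaban1983to89.ExpMeanLog (deltaSU)
open Literature.MathematicalPhysics.QuantumFieldTheory.Balaban1983to89.LatticeWordStokes (dist1_loopHol_le)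

/-! ## §1 The closed profile `closure histGood` -/

/-- The closure of `histGood` lies in the `≤`-profile set (✓`closure_histProfile_subset_and_continuousAt`). [cite: Balaban1985UV3, (7) p.257] -/
theorem closure_histGood_subset_profile (F : T3Family) {J K : ℕ} (hJK : J ≤ K) {θ : ℕ → ℝ} {δ₀ : ℝ} (hδ₀ : 0 ≤ δ₀) (hθ : ∀ i, θ i < δ₀)
    (hsmall : (((((F.P K).d + 2) * (F.P K).L : ℕ) : ℝ) ^ 2 / 4) * δ₀ ≤ ExpMeanLog.deltaSU (Fin 2) / 2) :
    closure (histGood F ℰp θ K J) ⊆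
      {U | ∀ i, i ≤ K - J → ∀ p : Plaq (F.P K) i,
        dist1 (GaugeField.plaqHol (Averaging.iter (fun i => BlockAveraging.blockAvg (P := F.P K) (j := i) ℰp) i U) p) ≤ θ (K - i)} := by
  rw [Summit.QuantumFields.YangMills.Theorems.PosOnSmallReduction.histGood_eq_setOf_forall_le F θ hJK]
  have hKK : (F.P K).K = K := rfl
  have hdist : ∀ (j : ℕ) (p : Plaq (F.P K) j),
      Continuous fun U : GaugeField (F.P K) j (Matrix.specialUnitaryGroup (Fin 2) ℂ) => dist1 (GaugeField.plaqHol U p) := fun j p =>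
    (UnitaryModel.continuous_opDist1.comp (Literature.MathematicalPhysics.QuantumLattice.continuous_fundamentalRep (Fin 2))).comp
      (B12ContinuousTransportInvarianceOn.continuous_plaqHol_SU (N := 2) p)
  exact (closure_histProfile_subset_and_continuousAt (fun i => BlockAveraging.blockAvg (P := F.P K) (j := i) ℰp)
    (fun i => θ (K - i)) δ₀ hdist (fun j δ => Node00.isOpen_plaqSmall δ) (fun i => hθ _)
    (fun j _ => Summit.QuantumFields.YangMills.Theorems.FibrePositivity.continuousOn_blockAvg_expMeanLogSU hδ₀ hsmall) (K - J) (by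
      show K - J ≤ F.m + K; omega)).1

/-- On the closure of `histGood` every intermediate field is `δ₀`-small (plaquettes `≤ θ < δ₀`). [cite: Balaban1985UV3, (7) p.257] -/
theorem plaqSmall_iter_of_mem_closure_histGood (F : T3Family) {J K : ℕ} (hJK : J ≤ K) {θ : ℕ → ℝ} {δ₀ : ℝ} (hδ₀ : 0 ≤ δ₀) (hθ : ∀ i, θ i < δ₀)
    (hsmall : (((((F.P K).d + 2) * (F.P K).L : ℕ) : ℝ) ^ 2 / 4) * δ₀ ≤ ExpMeanLog.deltaSU (Fin 2) / 2)
    {U : GaugeField (F.P K) 0 (Matrix.specialUnitaryGroup (Fin 2) ℂ)} (hU : U ∈ closure (histGood F ℰp θ K J)) {k : ℕ} (hk : k ≤ K - J) :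
    PlaqSmall δ₀ (Averaging.iter (fun i => BlockAveraging.blockAvg (P := F.P K) (j := i) ℰp) k U) := fun p =>
  (closure_histGood_subset_profile F hJK hδ₀ hθ hsmall hU k hk p).trans_lt (hθ _)

/-- ★ The closure of `histGood` has STRICT small loop history below level `K − J` once `((d+2)L)²/4 · δ₀ < α`. [cite: Balaban1987RG1, (0.4) p.253 and (2.9) p.266] -/
theorem closure_histGood_subset_loopSmall_lt (F : T3Family) {J K : ℕ} (hJK : J ≤ K) {θ : ℕ → ℝ} {δ₀ α : ℝ} (hδ₀ : 0 ≤ δ₀) (hθ : ∀ i, θ i < δ₀)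
    (hsmall : (((((F.P K).d + 2) * (F.P K).L : ℕ) : ℝ) ^ 2 / 4) * δ₀ ≤ ExpMeanLog.deltaSU (Fin 2) / 2)
    (hD : (((((F.P K).d + 2) * (F.P K).L : ℕ) : ℝ) ^ 2 / 4) * δ₀ < α) :
    closure (histGood F ℰp θ K J) ⊆ {U | ∀ k, k < K - J → ∀ (c' : PBond (F.P K) (k + 1)) (i : Idx (F.P K)),
      dist1 (loopHol (Averaging.iter (fun i => BlockAveraging.blockAvg (P := F.P K) (j := i) ℰp) k U) c' i) < α} :=
  fun _ hU _ hk c' i =>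
    (dist1_loopHol_le hδ₀ (plaqSmall_iter_of_mem_closure_histGood F hJK hδ₀ hθ hsmall hU hk.le) c' i).trans_lt hD

/-- ★ The closure of `histGood` lies in the chart-window set (✓`self_mem_chainWindow` at the constant threshold `δ₀`). [cite: Balaban1987RG1, (0.4) p.253 and (2.9) p.266] -/
theorem closure_histGood_subset_charted (F : T3Family) {J K : ℕ} (hJK : J ≤ K) {θ : ℕ → ℝ} {δ₀ α : ℝ} (hδ₀ : 0 ≤ δ₀) (hθ : ∀ i, θ i < δ₀)
    (hsmall : (((((F.P K).d + 2) * (F.P K).L : ℕ) : ℝ) ^ 2 / 4) * δ₀ ≤ ExpMeanLog.deltaSU (Fin 2) / 2)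
    (hD : (((((F.P K).d + 2) * (F.P K).L : ℕ) : ℝ) ^ 2 / 4) * δ₀ < α) :
    closure (histGood F ℰp θ K J) ⊆ {U | ∀ c, U (iterCentralBond (K - J) c) ∈ chainWindow (N := 2) α (K - J) U c} := by
  intro U hU c
  have hn : K - J ≤ (F.P K).m + (F.P K).K := by
    show K - J ≤ F.m + K
    omega
  exact self_mem_chainWindow (N := 2) (fun _ => δ₀) (fun _ => hδ₀) (fun _ => hD.le) hn U c fun k hk =>
    plaqSmall_iter_of_mem_closure_histGood F hJK hδ₀ hθ hsmall hU hk.le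

/-- The frontier of the closure of `histGood` lies on the exact threshold levels. [cite: Balaban1985UV3, (7) p.257] -/
theorem frontier_closure_histGood_subset (F : T3Family) {J K : ℕ} (hJK : J ≤ K) {θ : ℕ → ℝ} {δ₀ : ℝ} (hδ₀ : 0 ≤ δ₀) (hθ : ∀ i, θ i < δ₀)
    (hsmall : (((((F.P K).d + 2) * (F.P K).L : ℕ) : ℝ) ^ 2 / 4) * δ₀ ≤ ExpMeanLog.deltaSU (Fin 2) / 2) :
    frontier (closure (histGood F ℰp θ K J)) ⊆
      {U | ∃ j, j ≤ K - J ∧ ∃ p : Plaq (F.P K) j,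
        dist1 (GaugeField.plaqHol (Averaging.iter (fun i => BlockAveraging.blockAvg (P := F.P K) (j := i) ℰp) j U) p) = θ (K - j)} :=
  frontier_closure_subset.trans (frontier_histGood_subset F hδ₀ hθ hsmall hJK)

/-! ## §2 The null row of the law from LEVEL flatness -/

/-- ★★ **THE NULL ROW**: over a datum `V` of the open window `O = {PlaqSmall (θ J)}`, for a.e. leaf point `z`, a LIVE closed-profile chart value lies in `histGood`
itself — exact threshold levels at heights `j < K − J` are avoided a.e. on the leaf (✓`levelFlat`, read at `U := Φ (V, z)` through the `charted` clause), and the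
top level is strict because `Ū⁽ᴷ⁻ᴶ⁾ (Φ (V, z))` is `V` read on run `K`. [cite: Balaban1985UV3, (7) p.257 and (28)-(31) p.263] -/
theorem null_row_of_levelFlat (F : T3Family) {J K : ℕ} (hJK : J ≤ K) {θ : ℕ → ℝ} (hθpos : ∀ i, 0 < θ i) {δ₀ α : ℝ} (hδ₀ : 0 ≤ δ₀) (hθ : ∀ i, θ i < δ₀)
    (hsmall : (((((F.P K).d + 2) * (F.P K).L : ℕ) : ℝ) ^ 2 / 4) * δ₀ ≤ ExpMeanLog.deltaSU (Fin 2) / 2)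
    (hα0 : 0 < α) (hα24 : α ≤ 1 / 24) (hα64 : 64 * α ≤ deltaSU (Fin 2)) (hαL : 157 * α < (((F.P K).L : ℝ) ^ ((F.P K).d - 1))⁻¹)
    (hgap : ∀ j (c : PBond (F.P K) (j + 1)), (offCard c : ℝ) / (Fintype.card (Idx (F.P K)) : ℝ) + 150 * α < 1)
    {Φ : GaugeField (F.P J) 0 (Matrix.specialUnitaryGroup (Fin 2) ℂ) × GaugeField (F.P K) 0 (Matrix.specialUnitaryGroup (Fin 2) ℂ) →
      GaugeField (F.P K) 0 (Matrix.specialUnitaryGroup (Fin 2) ℂ)}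
    {jac : GaugeField (F.P J) 0 (Matrix.specialUnitaryGroup (Fin 2) ℂ) × GaugeField (F.P K) 0 (Matrix.specialUnitaryGroup (Fin 2) ℂ) → ℝ≥0}
    {T : PBond (F.P K) (K - J) → GaugeField (F.P K) 0 (Matrix.specialUnitaryGroup (Fin 2) ℂ) → Set (Matrix.specialUnitaryGroup (Fin 2) ℂ)}
    {w : PBond (F.P K) (K - J) → PBond (F.P J) 0}
    (hne : ∀ V z, jac (V, z) ≠ 0 ↔ (∀ c, V (w c) ∈ T c z) ∧ Φ (V, z) ∈ closure (histGood F ℰp θ K J))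
    (hcharted : ∀ V z, (∀ c, V (w c) ∈ T c z) → (∀ b, (∀ c, iterCentralBond (K - J) c ≠ b) → Φ (V, z) b = z b) ∧
      (∀ c, Φ (V, z) (iterCentralBond (K - J) c) ∈ chainWindow (N := 2) α (K - J) (Φ (V, z)) c) ∧
      descendTo F ℰp J K hJK (Φ (V, z)) = V)
    (V : GaugeField (F.P J) 0 (Matrix.specialUnitaryGroup (Fin 2) ℂ)) (hV : PlaqSmall (θ J) V) :
    ∀ᵐ z ∂fieldMeasure (F.P K) 0 (Matrix.specialUnitaryGroup (Fin 2) ℂ), jac (V, z) ≠ 0 → Φ (V, z) ∈ histGood F ℰp θ K J := by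
  have hn : K - J ≤ (F.P K).m + (F.P K).K := by
    show K - J ≤ F.m + K
    omega
  have hs := F.sitesPerDir_eq (m := F.m) (K := J) (j := 0) (m' := F.m) (K' := K) (j' := K - J) (by omega)
  have hdesc : (descendTo F ℰp J K hJK : GaugeField (F.P K) 0 (Matrix.specialUnitaryGroup (Fin 2) ℂ) → GaugeField (F.P J) 0 _) =
      fieldShift hs ∘ Averaging.iter (fun i => BlockAveraging.blockAvg (P := F.P K) (j := i) ℰp) (K - J) := rfl
  have he'e : ∀ y : GaugeField (F.P K) (K - J) (Matrix.specialUnitaryGroup (Fin 2) ℂ), fieldShift hs.symm (fieldShift hs y) = y :=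
    fieldShift_fieldShift_symm hs
  have hiter_of_desc : ∀ U V, descendTo F ℰp J K hJK U = V →
      Averaging.iter (fun i => BlockAveraging.blockAvg (P := F.P K) (j := i) ℰp) (K - J) U = fieldShift hs.symm V := by
    intro U V h
    rw [hdesc, Function.comp_apply] at h
    rw [← h, he'e]
  have hae := Summit.QuantumFields.YangMills.Theorems.FluctuationComparisonRegPrIntLWreg.levelFlat F K (K - J) hn α hα0 hα24 hα64 hαL hgap
    (fun j => θ (K - j)) (fun j => (hθpos _).ne') (fieldShift hs.symm V)
  filter_upwards [hae] with z hz hj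
  obtain ⟨hT, hcl⟩ := (hne V z).1 hj
  obtain ⟨hoff, hwin, hd⟩ := hcharted V z hT
  have h2 := hiter_of_desc _ _ hd
  have hle := closure_histGood_subset_profile F hJK hδ₀ hθ hsmall hcl
  rw [Summit.QuantumFields.YangMills.Theorems.PosOnSmallReduction.histGood_eq_setOf_forall_le F θ hJK]
  intro j hjle p
  refine lt_of_le_of_ne (hle j hjle p) ?_
  rcases hjle.lt_or_eq with hlt | rfl
  · exact hz (Φ (V, z)) hoff hwin h2 j hlt p
  · rw [h2, Nat.sub_sub_self hJK]
    exact (lt_of_eq_of_lt (congrArg dist1 (plaqHol_fieldShift hs.symm V p)) (hV _)).ne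

end Summit.QuantumFields.YangMills.Theorems.FluctuationComparisonRegPrIntLS2BetaChartContClosedProfile

end
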